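import Mathlib
import HarnessLib
import Summits.HubbardSuperconductivity.HubbardSuperconductivity.Theorems.KLProgrammeKLRegimeFlowReadPrivLast

/-!
# Route `KLProgramme`, crux K3 — gen-8 ENGINE-FLOW child (stmt-HubbardSuperconductivity-20437 `KLRegimeEngineV17F2`), stub (C)
# `stub_twoLeg_curvature`, v2 text: «(P)-SWAP» — the step `(K₀, n) → (K, n+1)` from ANY four-term decomposition
# `ν_{n+1}(K) = δ_{n+1}(K₀) + R + T + J` (ruling (R116): cure of record (δ′) «LAST-STEP SWAP» for located item #20)

Seat hubbard-kl-k3c3-p1 (g12; row «δμ-flow with klAngularMean constant piece»).  At the last index `N = n_β + 1` p2 g17's (δ′) «SWAP» (memo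
LAST-THERMAL-SIZING-p2g17 §1, evidence #48 on 20437) re-brackets the cumulative reading at the NEW frame as

  `ν_N(K_N)(θ) = δ_N(K_{n_β})(θ) + R(θ) + T(θ) + J(θ)`

— slice increment in the OLD frame ((A)-OLD-FRAME, c4a-1's `TwoLegCurveJetBound … (K_{n_β}) N` + structured value), frame RESPONSE `R` at scale `N` read at
the old Fermi point (p2 F2/F3: `e_R = (0,1,1,1,1)·|U|`, `e′_R = (1,0,0,0,0)`, `e_R 0 = 0`), transport `T` of the new-frame symbol, Jackson remainder `J`
verbatim — the identity itself being p2's `klLocalPart_succ_eq_swap` (F1 `…EngineLastStepFrameIdentity`).  This file is the RECEIVER, written over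
ABSTRACT brackets `R T J : ℝ → ℝ` and the identity as a hypothesis `hswap`, so that it is independent of the literal form of p2's brackets:

* §1 `jets_add_three` (three `C⁴` brackets with `curveJetBar` rows add), `abs_add_three_le_of_fst_eq_zero` (pure-`U²` value of the sum when the un-primed
  `k = 0` entries vanish);
* §2 **`twoLegReadPriv_succ_of_swap`** (any frames `K₀, K`, any `n`): `hswap` + (A) at `(K₀, n+1)` (jets `(cA, cA′)`, structured value budget `a`) + the three
  brackets' `C⁴`/jet rows at index `n+1` with `eR 0 = eT 0 = eJ 0 = 0` + the fits `cA + (eR + eT + eJ) ≤ cc` (primed alike), `a + (eR′0 + eT′0 + eJ′0) ≤ x₀/2`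
  ⟹ the private pair at `(K, n+1)` — the literal analogue of «(P)-STEP» `twoLegReadPriv_flow_succ` (p598604) with `hA` one frame back and `hB ↦ hR`,
  `hT ↦ hT′`, NO index shift; `twoLegReadPriv_succ_of_swap_structured` (value of `R` structured around a constant `τ_R` instead of `eR 0 = 0`);
* §3 the flow instance `(K₀, K) := (klFlowFrameU … n, klFlowFrameU … (n+1))` and the REGISTERED conclusion at `(K_{n+1}, n+1)` (`twoLegRead_flow_succ_of_swap_registered`),
  which is the `hlast` of the driver `twoLegRead_registered_all` (…FlowReadPrivLast §6) at `n = nScales β`.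

Bookkeeping only; no definition; nothing here asserts any stub of 20437, K3 or superconductivity.
References: BGM 2006 §2.4 (2.36)–(2.42) [cite: BenfattoGiulianiMastropietro2006].
-/

noncomputable section

namespace Summit.HubbardSuperconductivity.HubbardSuperconductivity.Theorems.KLRegimeSplit

set_option linter.dupNamespace false -- summit = problem name (single-conjunct summit), D-0017

open Real Literature.MathematicalPhysics.QuantumLattice Literature.Probability.LatticeModels
open Literature.MathematicalPhysics.QuantumLattice.FermiRG

/-! ## §1 Three brackets add -/

/-- **Jets of a three-bracket sum**: `R, T, J` `C⁴` with `|∂ᵏ·| ≤ curveJetBar e• e•′ U k m` (`k ≤ 4`) ⟹ `R + T + J` is `C⁴` with rows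
`curveJetBar (eR + eT + eJ) (eR′ + eT′ + eJ′) U k m`. -/
theorem jets_add_three {R T J : ℝ → ℝ} {eR eR' eT eT' eJ eJ' : ℕ → ℝ} {U : ℝ} {m : ℕ}
    (hRdiff : ContDiff ℝ 4 R) (hR : ∀ k ≤ 4, ∀ θ : ℝ, |iteratedDeriv k R θ| ≤ curveJetBar eR eR' U k m)
    (hTdiff : ContDiff ℝ 4 T) (hT : ∀ k ≤ 4, ∀ θ : ℝ, |iteratedDeriv k T θ| ≤ curveJetBar eT eT' U k m)
    (hJdiff : ContDiff ℝ 4 J) (hJ : ∀ k ≤ 4, ∀ θ : ℝ, |iteratedDeriv k J θ| ≤ curveJetBar eJ eJ' U k m) :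
    ContDiff ℝ 4 (fun θ : ℝ => R θ + T θ + J θ) ∧
      ∀ k ≤ 4, ∀ θ : ℝ, |iteratedDeriv k (fun θ : ℝ => R θ + T θ + J θ) θ| ≤
        curveJetBar (fun k => eR k + eT k + eJ k) (fun k => eR' k + eT' k + eJ' k) U k m := by
  have hsum : (fun θ : ℝ => R θ + T θ + J θ) = (R + T) + J := by funext θ; simp
  rw [hsum]
  have hRT : ContDiff ℝ 4 (R + T) := hRdiff.add hTdiff
  refine ⟨hRT.add hJdiff, fun k hk θ => ?_⟩
  have hk' : (k : WithTop ℕ∞) ≤ 4 := by exact_mod_cast hk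
  rw [iteratedDeriv_add (hRT.contDiffAt.of_le hk') (hJdiff.contDiffAt.of_le hk'),
    iteratedDeriv_add (hRdiff.contDiffAt.of_le hk') (hTdiff.contDiffAt.of_le hk'), ← curveJetBar_add_three]
  calc |iteratedDeriv k R θ + iteratedDeriv k T θ + iteratedDeriv k J θ|
      ≤ |iteratedDeriv k R θ + iteratedDeriv k T θ| + |iteratedDeriv k J θ| := abs_add_le _ _
    _ ≤ (|iteratedDeriv k R θ| + |iteratedDeriv k T θ|) + |iteratedDeriv k J θ| := by gcongr; exact abs_add_le _ _
    _ ≤ curveJetBar eR eR' U k m + curveJetBar eT eT' U k m + curveJetBar eJ eJ' U k m :=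
        add_le_add (add_le_add (hR k hk θ) (hT k hk θ)) (hJ k hk θ)

/-- **Pure-`U²` value of the sum**: with ZERO un-primed `k = 0` entries the `k = 0` row reads `|R + T + J| ≤ (eR′0 + eT′0 + eJ′0)·U²·4^{−2m}` — the sum is
within that of the constant `0`. -/
theorem abs_add_three_le_of_fst_eq_zero {R T J : ℝ → ℝ} {eR eR' eT eT' eJ eJ' : ℕ → ℝ} {U : ℝ} {m : ℕ}
    (h : ∀ k ≤ 4, ∀ θ : ℝ, |iteratedDeriv k (fun θ : ℝ => R θ + T θ + J θ) θ| ≤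
      curveJetBar (fun k => eR k + eT k + eJ k) (fun k => eR' k + eT' k + eJ' k) U k m)
    (heR0 : eR 0 = 0) (heT0 : eT 0 = 0) (heJ0 : eJ 0 = 0) (θ : ℝ) :
    |(R θ + T θ + J θ) - 0| ≤ (eR' 0 + eT' 0 + eJ' 0) * U ^ 2 * (4 : ℝ) ^ (-2 * (m : ℤ)) := by
  rw [sub_zero]
  have h0 := h 0 (Nat.zero_le _) θ
  rw [iteratedDeriv_zero] at h0
  have he : (fun k => eR k + eT k + eJ k) 0 = 0 := by simp [heR0, heT0, heJ0]
  exact abs_le_of_curveJetBar_zero_of_fst_eq_zero he h0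

/-! ## §2 The step from a four-term SWAP decomposition (any frames) -/

section Model

variable {L M : ℕ} [NeZero L] [NeZero M]

/-- **«(P)-SWAP» — the private pair at `(K, n+1)` from ANY decomposition `ν_{n+1}(K) = δ_{n+1}(K₀) + R + T + J`** (frames `K₀` «old», `K` «new»):
the identity `hswap` (p2's `klLocalPart_succ_eq_swap` at the flow frames, or any other), (A) at `(K₀, n+1)` — jets `(cA, cA′)` and structured value
(budget `a`) of the slice increment in the OLD frame —, the three brackets `C⁴` with rows `curveJetBar e• e•′ U k (n+1)` and zero un-primed value entries,
and the fits ⟹ `TwoLegReadJetBound L M cc cc′ … K (n+1) ∧ TwoLegReadOscAt L M x₀ … K (n+1)`.  (Shape of «(P)-STEP» p598604 with `hA` one frame back,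
`hB ↦ hR`, `hT ↦ hT′`, `hJ` free; NO index shift.) -/
theorem twoLegReadPriv_succ_of_swap {β U μ : ℝ} {K₀ K : TrigPolyC4v} {n : ℕ} {R T J : ℝ → ℝ}
    {cA cA' eR eR' eT eT' eJ eJ' cc cc' : ℕ → ℝ} {τA a x₀ : ℝ}
    (hswap : ∀ θ : ℝ, klLocalPart L M β U μ K (n + 1) θ = klTwoLegCurveProfile L M β U μ K₀ (n + 1) θ + (R θ + T θ + J θ))
    (hA : TwoLegCurveJetBound L M cA cA' β U μ K₀ (n + 1))
    (hAval : ∀ θ : ℝ, |klTwoLegCurveProfile L M β U μ K₀ (n + 1) θ - τA| ≤ a * U ^ 2 * (4 : ℝ) ^ (-2 * ((n + 1 : ℕ) : ℤ)))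
    (hRdiff : ContDiff ℝ 4 R) (hR : ∀ k ≤ 4, ∀ θ : ℝ, |iteratedDeriv k R θ| ≤ curveJetBar eR eR' U k (n + 1))
    (hTdiff : ContDiff ℝ 4 T) (hT : ∀ k ≤ 4, ∀ θ : ℝ, |iteratedDeriv k T θ| ≤ curveJetBar eT eT' U k (n + 1))
    (hJdiff : ContDiff ℝ 4 J) (hJ : ∀ k ≤ 4, ∀ θ : ℝ, |iteratedDeriv k J θ| ≤ curveJetBar eJ eJ' U k (n + 1))
    (heR0 : eR 0 = 0) (heT0 : eT 0 = 0) (heJ0 : eJ 0 = 0)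
    (hfit : ∀ k, cA k + (eR k + eT k + eJ k) ≤ cc k) (hfit' : ∀ k, cA' k + (eR' k + eT' k + eJ' k) ≤ cc' k)
    (hfitO : a + (eR' 0 + eT' 0 + eJ' 0) ≤ x₀ / 2) :
    TwoLegReadJetBound L M cc cc' β U μ K (n + 1) ∧ TwoLegReadOscAt L M x₀ β U μ K (n + 1) := by
  obtain ⟨hPdiff, hP⟩ := jets_add_three hRdiff hR hTdiff hT hJdiff hJ
  have hfun : (fun θ : ℝ => klLocalPart L M β U μ K (n + 1) θ) =
      klTwoLegCurveProfile L M β U μ K₀ (n + 1) + fun θ : ℝ => R θ + T θ + J θ := funext fun θ => by simpa using hswap θ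
  -- jets
  have hjets : TwoLegReadJetBound L M (fun k => cA k + (eR k + eT k + eJ k)) (fun k => cA' k + (eR' k + eT' k + eJ' k)) β U μ K (n + 1) := by
    refine ⟨?_, fun k hk θ => ?_⟩
    · rw [hfun]; exact hA.1.add hPdiff
    · rw [hfun, C4a.curveJetBar_add]
      have hk' : (k : WithTop ℕ∞) ≤ 4 := by exact_mod_cast hk
      rw [iteratedDeriv_add (hA.1.contDiffAt.of_le hk') (hPdiff.contDiffAt.of_le hk')]
      exact (abs_add_le _ _).trans (add_le_add (hA.2 k hk θ) (hP k hk θ))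
  have hcc : TwoLegReadJetBound L M cc cc' β U μ K (n + 1) := hjets.mono hfit hfit'
  refine ⟨hcc, ?_⟩
  -- mean-free value: `ν_{n+1}(K)` within `(a + Σe′0)·U²·4^{−2(n+1)}` of the constant `τ_A`
  have hP0 := abs_add_three_le_of_fst_eq_zero hP heR0 heT0 heJ0
  refine twoLegReadOscAt_of_abs_sub_const_le hcc.1.continuous τA fun θ => ?_
  have hnn := sq_mul_four_zpow_nonneg U (n + 1)
  have hsplit : klLocalPart L M β U μ K (n + 1) θ - τA =
      (klTwoLegCurveProfile L M β U μ K₀ (n + 1) θ - τA) + ((R θ + T θ + J θ) - 0) := by rw [hswap θ]; ring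
  rw [hsplit]
  calc |(klTwoLegCurveProfile L M β U μ K₀ (n + 1) θ - τA) + ((R θ + T θ + J θ) - 0)|
      ≤ a * U ^ 2 * (4 : ℝ) ^ (-2 * ((n + 1 : ℕ) : ℤ)) + (eR' 0 + eT' 0 + eJ' 0) * U ^ 2 * (4 : ℝ) ^ (-2 * ((n + 1 : ℕ) : ℤ)) :=
        (abs_add_le _ _).trans (add_le_add (hAval θ) (hP0 θ))
    _ = (a + (eR' 0 + eT' 0 + eJ' 0)) * (U ^ 2 * (4 : ℝ) ^ (-2 * ((n + 1 : ℕ) : ℤ))) := by ring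
    _ ≤ x₀ / 2 * (U ^ 2 * (4 : ℝ) ^ (-2 * ((n + 1 : ℕ) : ℤ))) := mul_le_mul_of_nonneg_right hfitO hnn
    _ = x₀ / 2 * U ^ 2 * (4 : ℝ) ^ (-2 * ((n + 1 : ℕ) : ℤ)) := by ring

/-- **«(P)-SWAP», structured response value**: as `twoLegReadPriv_succ_of_swap` but with the response's `k = 0` row replaced by a STRUCTURED value
`|R(θ) − τ_R| ≤ r·U²·4^{−2(n+1)}` (no `eR 0 = 0` asked; the un-primed `k = 0` fit is then on `cA 0 + (eT 0 + eJ 0)` only through `hfit`, which may take any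
`eR 0`), Osc fit `a + r + (eT′0 + eJ′0) ≤ x₀/2`. -/
theorem twoLegReadPriv_succ_of_swap_structured {β U μ : ℝ} {K₀ K : TrigPolyC4v} {n : ℕ} {R T J : ℝ → ℝ}
    {cA cA' eR eR' eT eT' eJ eJ' cc cc' : ℕ → ℝ} {τA a τR r x₀ : ℝ}
    (hswap : ∀ θ : ℝ, klLocalPart L M β U μ K (n + 1) θ = klTwoLegCurveProfile L M β U μ K₀ (n + 1) θ + (R θ + T θ + J θ))
    (hA : TwoLegCurveJetBound L M cA cA' β U μ K₀ (n + 1))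
    (hAval : ∀ θ : ℝ, |klTwoLegCurveProfile L M β U μ K₀ (n + 1) θ - τA| ≤ a * U ^ 2 * (4 : ℝ) ^ (-2 * ((n + 1 : ℕ) : ℤ)))
    (hRdiff : ContDiff ℝ 4 R) (hR : ∀ k ≤ 4, ∀ θ : ℝ, |iteratedDeriv k R θ| ≤ curveJetBar eR eR' U k (n + 1))
    (hRval : ∀ θ : ℝ, |R θ - τR| ≤ r * U ^ 2 * (4 : ℝ) ^ (-2 * ((n + 1 : ℕ) : ℤ)))
    (hTdiff : ContDiff ℝ 4 T) (hT : ∀ k ≤ 4, ∀ θ : ℝ, |iteratedDeriv k T θ| ≤ curveJetBar eT eT' U k (n + 1))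
    (hJdiff : ContDiff ℝ 4 J) (hJ : ∀ k ≤ 4, ∀ θ : ℝ, |iteratedDeriv k J θ| ≤ curveJetBar eJ eJ' U k (n + 1))
    (heT0 : eT 0 = 0) (heJ0 : eJ 0 = 0)
    (hfit : ∀ k, cA k + (eR k + eT k + eJ k) ≤ cc k) (hfit' : ∀ k, cA' k + (eR' k + eT' k + eJ' k) ≤ cc' k)
    (hfitO : a + r + (eT' 0 + eJ' 0) ≤ x₀ / 2) :
    TwoLegReadJetBound L M cc cc' β U μ K (n + 1) ∧ TwoLegReadOscAt L M x₀ β U μ K (n + 1) := by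
  obtain ⟨hPdiff, hP⟩ := jets_add_three hRdiff hR hTdiff hT hJdiff hJ
  have hfun : (fun θ : ℝ => klLocalPart L M β U μ K (n + 1) θ) =
      klTwoLegCurveProfile L M β U μ K₀ (n + 1) + fun θ : ℝ => R θ + T θ + J θ := funext fun θ => by simpa using hswap θ
  have hjets : TwoLegReadJetBound L M (fun k => cA k + (eR k + eT k + eJ k)) (fun k => cA' k + (eR' k + eT' k + eJ' k)) β U μ K (n + 1) := by
    refine ⟨?_, fun k hk θ => ?_⟩
    · rw [hfun]; exact hA.1.add hPdiff
    · rw [hfun, C4a.curveJetBar_add]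
      have hk' : (k : WithTop ℕ∞) ≤ 4 := by exact_mod_cast hk
      rw [iteratedDeriv_add (hA.1.contDiffAt.of_le hk') (hPdiff.contDiffAt.of_le hk')]
      exact (abs_add_le _ _).trans (add_le_add (hA.2 k hk θ) (hP k hk θ))
  have hcc : TwoLegReadJetBound L M cc cc' β U μ K (n + 1) := hjets.mono hfit hfit'
  refine ⟨hcc, ?_⟩
  -- the `T + J` part has a pure-`U²` value row
  obtain ⟨-, hTJ⟩ := jets_add_three (eR := fun _ => 0) (eR' := fun _ => 0) (R := fun _ => 0) contDiff_const
    (fun k _ θ => by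
      rw [iteratedDeriv_const]; simpa using curveJetBar_nonneg (fun _ => le_rfl) (fun _ => le_rfl) U k (n + 1))
    hTdiff hT hJdiff hJ
  have hTJ0 := abs_add_three_le_of_fst_eq_zero hTJ rfl heT0 heJ0
  refine twoLegReadOscAt_of_abs_sub_const_le hcc.1.continuous (τA + τR) fun θ => ?_
  have hnn := sq_mul_four_zpow_nonneg U (n + 1)
  have hsplit : klLocalPart L M β U μ K (n + 1) θ - (τA + τR) =
      (klTwoLegCurveProfile L M β U μ K₀ (n + 1) θ - τA) + (R θ - τR) + (((0 : ℝ) + T θ + J θ) - 0) := by rw [hswap θ]; ring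
  rw [hsplit]
  calc |(klTwoLegCurveProfile L M β U μ K₀ (n + 1) θ - τA) + (R θ - τR) + (((0 : ℝ) + T θ + J θ) - 0)|
      ≤ |(klTwoLegCurveProfile L M β U μ K₀ (n + 1) θ - τA) + (R θ - τR)| + |((0 : ℝ) + T θ + J θ) - 0| := abs_add_le _ _
    _ ≤ (a * U ^ 2 * (4 : ℝ) ^ (-2 * ((n + 1 : ℕ) : ℤ)) + r * U ^ 2 * (4 : ℝ) ^ (-2 * ((n + 1 : ℕ) : ℤ))) +
          ((0 : ℝ) + eT' 0 + eJ' 0) * U ^ 2 * (4 : ℝ) ^ (-2 * ((n + 1 : ℕ) : ℤ)) :=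
        add_le_add ((abs_add_le _ _).trans (add_le_add (hAval θ) (hRval θ))) (hTJ0 θ)
    _ = (a + r + (eT' 0 + eJ' 0)) * (U ^ 2 * (4 : ℝ) ^ (-2 * ((n + 1 : ℕ) : ℤ))) := by ring
    _ ≤ x₀ / 2 * (U ^ 2 * (4 : ℝ) ^ (-2 * ((n + 1 : ℕ) : ℤ))) := mul_le_mul_of_nonneg_right hfitO hnn
    _ = x₀ / 2 * U ^ 2 * (4 : ℝ) ^ (-2 * ((n + 1 : ℕ) : ℤ)) := by ring

/-! ## §3 The flow instance and the registered conclusion at the last index -/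

/-- **«(P)-SWAP» at the flow frames** `(K₀, K) := (K_n, K_{n+1})`: the private pair at `(K_{n+1}, n+1)` (then `twoLegRead_registered_of_priv`, or the
driver `twoLegRead_registered_all` with this as its last/any step). -/
theorem twoLegReadPriv_flow_succ_of_swap (β U μ : ℝ) {n : ℕ} {R T J : ℝ → ℝ}
    {cA cA' eR eR' eT eT' eJ eJ' cc cc' : ℕ → ℝ} {τA a x₀ : ℝ}
    (hswap : ∀ θ : ℝ, klLocalPart L M β U μ (klFlowFrameU L M β U μ (n + 1)) (n + 1) θ =
      klTwoLegCurveProfile L M β U μ (klFlowFrameU L M β U μ n) (n + 1) θ + (R θ + T θ + J θ))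
    (hA : TwoLegCurveJetBound L M cA cA' β U μ (klFlowFrameU L M β U μ n) (n + 1))
    (hAval : ∀ θ : ℝ, |klTwoLegCurveProfile L M β U μ (klFlowFrameU L M β U μ n) (n + 1) θ - τA| ≤
      a * U ^ 2 * (4 : ℝ) ^ (-2 * ((n + 1 : ℕ) : ℤ)))
    (hRdiff : ContDiff ℝ 4 R) (hR : ∀ k ≤ 4, ∀ θ : ℝ, |iteratedDeriv k R θ| ≤ curveJetBar eR eR' U k (n + 1))
    (hTdiff : ContDiff ℝ 4 T) (hT : ∀ k ≤ 4, ∀ θ : ℝ, |iteratedDeriv k T θ| ≤ curveJetBar eT eT' U k (n + 1))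
    (hJdiff : ContDiff ℝ 4 J) (hJ : ∀ k ≤ 4, ∀ θ : ℝ, |iteratedDeriv k J θ| ≤ curveJetBar eJ eJ' U k (n + 1))
    (heR0 : eR 0 = 0) (heT0 : eT 0 = 0) (heJ0 : eJ 0 = 0)
    (hfit : ∀ k, cA k + (eR k + eT k + eJ k) ≤ cc k) (hfit' : ∀ k, cA' k + (eR' k + eT' k + eJ' k) ≤ cc' k)
    (hfitO : a + (eR' 0 + eT' 0 + eJ' 0) ≤ x₀ / 2) :
    TwoLegReadJetBound L M cc cc' β U μ (klFlowFrameU L M β U μ (n + 1)) (n + 1) ∧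
      TwoLegReadOscAt L M x₀ β U μ (klFlowFrameU L M β U μ (n + 1)) (n + 1) :=
  twoLegReadPriv_succ_of_swap hswap hA hAval hRdiff hR hTdiff hT hJdiff hJ heR0 heT0 heJ0 hfit hfit' hfitO

/-- **The REGISTERED pair of stub (C) v2 at `(K_{n+1}, n+1)` from a SWAP decomposition** with fits straight to `klC4aJetC2`, `klC4aJetC′ P R` and
`2·(a + Σe′0) ≤ klReadOscC P R` — the `hlast` of `twoLegRead_registered_all` at `n = nScales β` (no private table needed at the last index). -/
theorem twoLegRead_flow_succ_of_swap_registered {P : SplitConsts} {R' : RenConsts} (β U μ : ℝ) {n : ℕ} {R T J : ℝ → ℝ}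
    {cA cA' eR eR' eT eT' eJ eJ' : ℕ → ℝ} {τA a : ℝ}
    (hswap : ∀ θ : ℝ, klLocalPart L M β U μ (klFlowFrameU L M β U μ (n + 1)) (n + 1) θ =
      klTwoLegCurveProfile L M β U μ (klFlowFrameU L M β U μ n) (n + 1) θ + (R θ + T θ + J θ))
    (hA : TwoLegCurveJetBound L M cA cA' β U μ (klFlowFrameU L M β U μ n) (n + 1))
    (hAval : ∀ θ : ℝ, |klTwoLegCurveProfile L M β U μ (klFlowFrameU L M β U μ n) (n + 1) θ - τA| ≤
      a * U ^ 2 * (4 : ℝ) ^ (-2 * ((n + 1 : ℕ) : ℤ)))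
    (hRdiff : ContDiff ℝ 4 R) (hR : ∀ k ≤ 4, ∀ θ : ℝ, |iteratedDeriv k R θ| ≤ curveJetBar eR eR' U k (n + 1))
    (hTdiff : ContDiff ℝ 4 T) (hT : ∀ k ≤ 4, ∀ θ : ℝ, |iteratedDeriv k T θ| ≤ curveJetBar eT eT' U k (n + 1))
    (hJdiff : ContDiff ℝ 4 J) (hJ : ∀ k ≤ 4, ∀ θ : ℝ, |iteratedDeriv k J θ| ≤ curveJetBar eJ eJ' U k (n + 1))
    (heR0 : eR 0 = 0) (heT0 : eT 0 = 0) (heJ0 : eJ 0 = 0)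
    (hfit : ∀ k, cA k + (eR k + eT k + eJ k) ≤ klC4aJetC2 k) (hfit' : ∀ k, cA' k + (eR' k + eT' k + eJ' k) ≤ klC4aJetC' P R' k)
    (hfitO : 2 * (a + (eR' 0 + eT' 0 + eJ' 0)) ≤ klReadOscC P R') :
    TwoLegReadJetBound L M klC4aJetC2 (klC4aJetC' P R') β U μ (klFlowFrameU L M β U μ (n + 1)) (n + 1) ∧
      TwoLegReadOscAt L M (klReadOscC P R') β U μ (klFlowFrameU L M β U μ (n + 1)) (n + 1) :=
  twoLegReadPriv_flow_succ_of_swap β U μ hswap hA hAval hRdiff hR hTdiff hT hJdiff hJ heR0 heT0 heJ0 hfit hfit' (by linarith)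

end Model

end Summit.HubbardSuperconductivity.HubbardSuperconductivity.Theorems.KLRegimeSplit

end
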